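import Summits.CriticalPhenomena.PercolationContinuityZ3.Theorems.SahiMasterFamilyPhiScale
import Summits.CriticalPhenomena.PercolationContinuityZ3.Theorems.SahiMasterFamilyPhiOrbit

/-!
# The SHARP vertex inequality, every order: capping an index can only DECREASE `Φ`, and the capped value is the
# (nonnegative) absorption factor — `Φ_{k+1}(1_𝒰) ≥ Φ_{k+1}(1_{𝒰 ∪ ⟨t₀⟩}) ≥ 0` for every union-closed `𝒰 ∋ univ` and every index `t₀`

Unit `prim-masterthm-p4` (gen 17; crux anchor stmt-CriticalPhenomena-4575, helper work; memo
`run/shared/lean/prim/prim-masterthm/prim-masterthm-p4/P4-GEN17-REPORT.md` §2).  Companion of `…PrincipalCapStep` (gen 13's abstract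
step), `…PhiVertex` (gen 14: the vertex conjecture (V) is a theorem at every order) and `…PhiScale` (vertices are hereditarily honest).

Gen 16 (report §12) observed numerically a SHARP FORM (V♯) of the vertex inequality and recorded it as conjectural for all `k`:
in the counting variables `N_𝒰(S) = #{σ ∈ Sym(S) : no cycle support of σ lies in 𝒰}` it reads `k·N(T) ≤ (k−1)·Σ_{i∈T} N(T∖i)`,
i.e. `Φ_T(1_𝒰) = Σ_i N(T∖i) − N(T) ≥ (1/k)·Σ_{i} N(T∖i)`, with equality at the complementary pairs `𝒰 = {A, Aᶜ, T}`.
It is a COROLLARY of the abstract step, pointwise in the index: the step proves `Φ(β) ≥ [Sahi's functional of the comparison family]`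
and the right-hand side is `Φ` of the CAPPED set function `cap β := (B ↦ 1 if last ∈ B, β_B otherwise)`.

**THEOREM `phiSet_cap_le` (every order).**  Let `β : Finset (Fin (k+1)) → ℝ` with `β ≤ 1`, `β univ = 1`, all honest sub-functionals
avoiding the last index nonnegative.  Then `0 ≤ Φ_{k+1}(cap β) ≤ Φ_{k+1}(β)`; exactly,
`Φ_{k+1}(β) − Φ_{k+1}(cap β) = Σ_{last ∈ B ≠ univ} (|B|−1)!·(1 − β_B)·Φ_{Bᶜ}(β|_{Bᶜ})` (block expansion along the last index
[LiebSahi2021, Prop. 3.4] in the canonical signed model; every summand is `≥ 0` under the hypotheses), and `Φ_{k+1}(cap β)` is the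
absorption factor `Σ_{σ ∈ S_k} ∏_{c ∈ cyc σ} (1 − β_c)` of `…PrincipalCapStep.phiSet_nonneg_of_last_eq_one`.

**COROLLARY (V♯) at the vertices** (`phiSet_indicator_capFamily_le`, `phiSet_indicator_capFamily_le_of_mem`, cycle form
`sum_perm_sign_capFamily_le`): for every union-closed family `𝒰 ∋ univ` of subsets of `Fin (k+1)` and every index `t₀`, the family
`𝒰 ∪ ⟨t₀⟩` (`⟨t₀⟩` = all sets containing `t₀`) is again union-closed and
`0 ≤ Σ_{σ : cycles ∈ 𝒰 ∪ ⟨t₀⟩} (−1)^{#cyc−1} ≤ Σ_{σ : cycles ∈ 𝒰} (−1)^{#cyc−1}`.  The middle term is `N_𝒰(T∖t₀)` (expand along the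
cycle through `t₀`, whose support is automatically in `⟨t₀⟩`, and use inclusion–exclusion over the `𝒰`-cycles of a permutation of
`T∖t₀`; memo §2), which gives gen 16's (V♯) verbatim; the faces `Z_{ab}` of the census (two capped indices ⇒ `Φ = 0`, since
`N_{𝒰∪⟨a⟩}(T∖b) = 0`) are the case of equality `0 = 0`.  HONEST FRAMING: statements about the `0/1` points (and, for `phiSet_cap_le`,
about points all of whose honest sub-functionals are already known nonnegative); `(UC-hull)_k`, `F^UC(k)` (k ≥ 8), Sahi's `C_k`,
Kahn's Conjecture 5 and the master theorem remain OPEN.  Axioms standard. [this work]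
-/

noncomputable section

open scoped Classical

namespace Summit.CriticalPhenomena.PercolationContinuityZ3.Theorems

namespace PhiVertexSharp

open Finset Function
open Literature.Combinatorics.Sahi2008
open Literature.Combinatorics.Sahi2008.CycleForm
open PrincipalCapBeta (phiSet realF realW)
open PrincipalCapStep (ex_fTop prod_gFam_eq_fTop coRest_gFam_eq gFam_castSucc coRest_realF_eq phiSet_nonneg_of_last_eq_one)

variable {k : ℕ}

/-! ### The capped set function is the moment function of the comparison family -/

/-- Moments of the comparison family `snoc (realF ∘ castSucc) (∏ realF)` in the signed model of `β` (`β univ = 1`): the CAPPED set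
function `B ↦ 1` if `last ∈ B`, `β_B` otherwise. [this work] -/
theorem ex_prod_gFam (β : Finset (Fin (k + 1)) → ℝ) (huniv : β univ = 1) (B : Finset (Fin (k + 1))) :
    ex (realW β) (∏ j ∈ B, (Fin.snoc (fun j : Fin k => realF j.castSucc) (∏ i : Fin (k + 1), realF i) :
      Fin (k + 1) → Finset (Fin (k + 1)) → ℝ) j) = if Fin.last k ∈ B then 1 else β B := by
  by_cases hlast : Fin.last k ∈ B
  · rw [if_pos hlast, prod_gFam_eq_fTop hlast, ex_fTop, huniv]
  · rw [if_neg hlast]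
    have e1 : (∏ j ∈ B, (Fin.snoc (fun j : Fin k => realF j.castSucc) (∏ i : Fin (k + 1), realF i) :
        Fin (k + 1) → Finset (Fin (k + 1)) → ℝ) j) = ∏ j ∈ B, (realF j : Finset (Fin (k + 1)) → ℝ) := by
      refine prod_congr rfl fun j hj => ?_
      have hj' : j ≠ Fin.last k := fun h => hlast (h ▸ hj)
      obtain ⟨j', rfl⟩ := Fin.exists_castSucc_eq.2 hj'
      exact gFam_castSucc j'
    rw [e1, PrincipalCapBeta.ex_realW_prod]

/-- `Φ_{k+1}(cap β)` is Sahi's functional of the comparison family in the signed model of `β`. [this work] -/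
theorem phiSet_cap_eq_sahiE (β : Finset (Fin (k + 1)) → ℝ) (huniv : β univ = 1) :
    phiSet (k + 1) (fun B => if Fin.last k ∈ B then 1 else β B) =
      sahiE (realW β) (k + 1) (Fin.snoc (fun j : Fin k => realF j.castSucc) (∏ i : Fin (k + 1), realF i) :
        Fin (k + 1) → Finset (Fin (k + 1)) → ℝ) := by
  rw [PrincipalCapBeta.sahiE_eq_phiSet]
  congr 1
  funext B
  exact (ex_prod_gFam β huniv B).symm

/-! ### Capping decreases `Φ` (the abstract step, sharp form) -/

/-- **Capping is free of charge: `Φ_{k+1}(cap β) ≥ 0`** whenever `β ≤ 1` (gen 13's absorbed-slot lemma). [this work] -/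
theorem phiSet_cap_nonneg (β : Finset (Fin (k + 1)) → ℝ) (h1 : ∀ B, β B ≤ 1) :
    0 ≤ phiSet (k + 1) (fun B => if Fin.last k ∈ B then 1 else β B) :=
  phiSet_nonneg_of_last_eq_one _ (fun B => by
    by_cases h : Fin.last k ∈ B
    · rw [if_pos h]
    · rw [if_neg h]; exact h1 B) (fun B hB => if_pos hB)

/-- **THE SHARP ABSTRACT STEP (every order): capping the last index can only decrease `Φ`.**  Let `β ≤ 1`, `β univ = 1`, and
suppose every honest sub-functional avoiding the last index is nonnegative.  Then `Φ_{k+1}(cap β) ≤ Φ_{k+1}(β)`, where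
`cap β = (B ↦ 1 if last ∈ B, β_B otherwise)`; the difference is `Σ_{last∈B≠univ} (|B|−1)!(1−β_B)Φ_{Bᶜ}(β|) ≥ 0`. [this work] -/
theorem phiSet_cap_le (β : Finset (Fin (k + 1)) → ℝ) (h1 : ∀ B, β B ≤ 1) (huniv : β univ = 1)
    (hsub : ∀ (n : ℕ) (e : Fin (n + 1) ↪ Fin (k + 1)), (∀ j, e j ≠ Fin.last k) →
      0 ≤ phiSet (n + 1) (fun S => β (S.map e))) :
    phiSet (k + 1) (fun B => if Fin.last k ∈ B then 1 else β B) ≤ phiSet (k + 1) β := by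
  have hk : 1 ≤ k + 1 := Nat.succ_le_succ (Nat.zero_le k)
  have eF := sahiE_eq_sum_blocks (realW β) hk realF (Fin.last k)
  have eG := sahiE_eq_sum_blocks (realW β) hk (Fin.snoc (fun j : Fin k => realF j.castSucc) (∏ i : Fin (k + 1), realF i) :
    Fin (k + 1) → Finset (Fin (k + 1)) → ℝ) (Fin.last k)
  rw [phiSet_cap_eq_sahiE β huniv, PrincipalCapBeta.phiSet_eq_sahiE_real, eF, eG]
  refine sum_le_sum fun B hB => ?_
  have hlast : Fin.last k ∈ B := (mem_filter.1 hB).2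
  have mF : ex (realW β) (fun x => ∏ j ∈ B, realF j x) = β B := by
    have e1 : (fun x => ∏ j ∈ B, realF j x) = ∏ j ∈ B, (realF j : Finset (Fin (k + 1)) → ℝ) :=
      funext fun x => (Finset.prod_apply x B _).symm
    rw [e1, PrincipalCapBeta.ex_realW_prod]
  have mG : ex (realW β) (fun x => ∏ j ∈ B, (Fin.snoc (fun j : Fin k => realF j.castSucc) (∏ i : Fin (k + 1), realF i) :
      Fin (k + 1) → Finset (Fin (k + 1)) → ℝ) j x) = 1 := by
    have e1 : (fun x => ∏ j ∈ B, (Fin.snoc (fun j : Fin k => realF j.castSucc) (∏ i : Fin (k + 1), realF i) :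
        Fin (k + 1) → Finset (Fin (k + 1)) → ℝ) j x) =
        ∏ j ∈ B, (Fin.snoc (fun j : Fin k => realF j.castSucc) (∏ i : Fin (k + 1), realF i) :
          Fin (k + 1) → Finset (Fin (k + 1)) → ℝ) j :=
      funext fun x => (Finset.prod_apply x B _).symm
    rw [e1, prod_gFam_eq_fTop hlast, ex_fTop, huniv]
  rw [mF, mG, coRest_gFam_eq (realW β) hlast]
  refine mul_le_mul_of_nonneg_left ?_ (Nat.cast_nonneg _)
  by_cases hBu : B = univ
  · have hb : β B = 1 := by rw [hBu, huniv]
    rw [hb]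
  · obtain ⟨n, e, he, hc⟩ := coRest_realF_eq β hBu
    have hc0 : coRest (realW β) realF B ≤ 0 := by
      rw [hc, neg_nonpos]
      exact hsub n e fun j hj => he j (hj ▸ hlast)
    nlinarith [h1 B, hc0]

/-- The two inequalities together: `0 ≤ Φ_{k+1}(cap β) ≤ Φ_{k+1}(β)`. [this work] -/
theorem phiSet_cap_nonneg_and_le (β : Finset (Fin (k + 1)) → ℝ) (h1 : ∀ B, β B ≤ 1) (huniv : β univ = 1)
    (hsub : ∀ (n : ℕ) (e : Fin (n + 1) ↪ Fin (k + 1)), (∀ j, e j ≠ Fin.last k) →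
      0 ≤ phiSet (n + 1) (fun S => β (S.map e))) :
    0 ≤ phiSet (k + 1) (fun B => if Fin.last k ∈ B then 1 else β B) ∧
      phiSet (k + 1) (fun B => if Fin.last k ∈ B then 1 else β B) ≤ phiSet (k + 1) β :=
  ⟨phiSet_cap_nonneg β h1, phiSet_cap_le β h1 huniv hsub⟩

/-! ### (V♯) at the vertices: enlarging a union-closed family by a principal star decreases `Φ` -/

/-- The indicator of a union-closed family is `0/1`-valued. [this work] -/
theorem indicator_zero_one (𝒰 : Finset (Finset (Fin (k + 1)))) (B : Finset (Fin (k + 1))) :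
    (fun S : Finset (Fin (k + 1)) => if S ∈ 𝒰 then (1 : ℝ) else 0) B = 0 ∨
      (fun S : Finset (Fin (k + 1)) => if S ∈ 𝒰 then (1 : ℝ) else 0) B = 1 := by
  by_cases h : B ∈ 𝒰
  · exact Or.inr (if_pos h)
  · exact Or.inl (if_neg h)

/-- The indicator of a union-closed family is supermultiplicative. [this work] -/
theorem indicator_supermul (𝒰 : Finset (Finset (Fin (k + 1)))) (hU : ∀ A ∈ 𝒰, ∀ B ∈ 𝒰, A ∪ B ∈ 𝒰)
    (S T : Finset (Fin (k + 1))) :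
    (fun S : Finset (Fin (k + 1)) => if S ∈ 𝒰 then (1 : ℝ) else 0) S *
      (fun S : Finset (Fin (k + 1)) => if S ∈ 𝒰 then (1 : ℝ) else 0) T ≤
      (fun S : Finset (Fin (k + 1)) => if S ∈ 𝒰 then (1 : ℝ) else 0) (S ∪ T) := by
  by_cases hS : S ∈ 𝒰
  · by_cases hT : T ∈ 𝒰
    · simp only [if_pos hS, if_pos hT, if_pos (hU S hS T hT), mul_one, le_refl]
    · simp only [if_neg hT, mul_zero]; split_ifs <;> norm_num
  · simp only [if_neg hS, zero_mul]; split_ifs <;> norm_num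

/-- **(V♯) at the vertices, last index.**  For a union-closed family `𝒰 ∋ univ` of subsets of `Fin (k+1)`:
`Φ_{k+1}(1_{𝒰 ∪ ⟨last⟩}) ≤ Φ_{k+1}(1_𝒰)`, where `𝒰 ∪ ⟨last⟩` adds every set containing the last index. [this work] -/
theorem phiSet_indicator_capFamily_le (𝒰 : Finset (Finset (Fin (k + 1)))) (hU : ∀ A ∈ 𝒰, ∀ B ∈ 𝒰, A ∪ B ∈ 𝒰)
    (htop : univ ∈ 𝒰) :
    phiSet (k + 1) (fun S => if S ∈ 𝒰 ∨ Fin.last k ∈ S then 1 else 0) ≤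
      phiSet (k + 1) (fun S => if S ∈ 𝒰 then 1 else 0) := by
  have hcap : (fun S : Finset (Fin (k + 1)) => if S ∈ 𝒰 ∨ Fin.last k ∈ S then (1 : ℝ) else 0) =
      fun S => if Fin.last k ∈ S then 1 else (if S ∈ 𝒰 then (1 : ℝ) else 0) := by
    funext S
    by_cases h1 : Fin.last k ∈ S <;> by_cases h2 : S ∈ 𝒰 <;> simp [h1, h2]
  rw [hcap]
  refine phiSet_cap_le _ (fun B => ?_) (if_pos htop) (fun m e _ => ?_)
  · by_cases h : B ∈ 𝒰
    · rw [if_pos h]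
    · rw [if_neg h]; exact zero_le_one
  · exact PhiScale.phiSet_map_nonneg_of_zero_one _ (indicator_zero_one 𝒰) (indicator_supermul 𝒰 hU) m e

/-- … and the capped value is nonnegative: `0 ≤ Φ_{k+1}(1_{𝒰 ∪ ⟨last⟩})` (no hypothesis on `𝒰`). [this work] -/
theorem phiSet_indicator_capFamily_nonneg (𝒰 : Finset (Finset (Fin (k + 1)))) :
    0 ≤ phiSet (k + 1) (fun S => if S ∈ 𝒰 ∨ Fin.last k ∈ S then (1 : ℝ) else 0) := by
  have hcap : (fun S : Finset (Fin (k + 1)) => if S ∈ 𝒰 ∨ Fin.last k ∈ S then (1 : ℝ) else 0) =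
      fun S => if Fin.last k ∈ S then 1 else (if S ∈ 𝒰 then (1 : ℝ) else 0) := by
    funext S
    by_cases h1 : Fin.last k ∈ S <;> by_cases h2 : S ∈ 𝒰 <;> simp [h1, h2]
  rw [hcap]
  refine phiSet_cap_nonneg _ fun B => ?_
  by_cases h : B ∈ 𝒰
  · rw [if_pos h]
  · rw [if_neg h]; exact zero_le_one

/-- Relabelled families: `S ↦ σ(S)` pulls a union-closed family back to a union-closed family. [this work] -/
theorem mem_pullback_iff (σ : Equiv.Perm (Fin (k + 1))) (𝒰 : Finset (Finset (Fin (k + 1)))) (S : Finset (Fin (k + 1))) :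
    S ∈ 𝒰.image (fun A => A.map σ.symm.toEmbedding) ↔ S.map σ.toEmbedding ∈ 𝒰 := by
  constructor
  · intro h
    obtain ⟨A, hA, rfl⟩ := mem_image.1 h
    rw [Finset.map_map]
    have : σ.symm.toEmbedding.trans σ.toEmbedding = Function.Embedding.refl _ := by
      ext x; simp
    rw [this, Finset.map_refl]
    exact hA
  · intro h
    refine mem_image.2 ⟨S.map σ.toEmbedding, h, ?_⟩
    rw [Finset.map_map]
    have : σ.toEmbedding.trans σ.symm.toEmbedding = Function.Embedding.refl _ := by
      ext x; simp
    rw [this, Finset.map_refl]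

/-- **(V♯) at the vertices, any index `t₀`.**  For a union-closed family `𝒰 ∋ univ` of subsets of `Fin (k+1)` and any `t₀`:
`0 ≤ Φ_{k+1}(1_{𝒰 ∪ ⟨t₀⟩}) ≤ Φ_{k+1}(1_𝒰)` (relabel `t₀ ↔ last` by `PhiCert.phiSet_actV`). [this work] -/
theorem phiSet_indicator_capFamily_le_of_mem (𝒰 : Finset (Finset (Fin (k + 1)))) (hU : ∀ A ∈ 𝒰, ∀ B ∈ 𝒰, A ∪ B ∈ 𝒰)
    (htop : univ ∈ 𝒰) (t₀ : Fin (k + 1)) :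
    0 ≤ phiSet (k + 1) (fun S => if S ∈ 𝒰 ∨ t₀ ∈ S then (1 : ℝ) else 0) ∧
      phiSet (k + 1) (fun S => if S ∈ 𝒰 ∨ t₀ ∈ S then (1 : ℝ) else 0) ≤
        phiSet (k + 1) (fun S => if S ∈ 𝒰 then 1 else 0) := by
  set σ : Equiv.Perm (Fin (k + 1)) := Equiv.swap t₀ (Fin.last k) with hσ
  set 𝒱 : Finset (Finset (Fin (k + 1))) := 𝒰.image (fun A => A.map σ.symm.toEmbedding) with h𝒱
  have hV : ∀ A ∈ 𝒱, ∀ B ∈ 𝒱, A ∪ B ∈ 𝒱 := by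
    intro A hA B hB
    rw [h𝒱, mem_pullback_iff] at hA hB ⊢
    rw [Finset.map_union]
    exact hU _ hA _ hB
  have hVtop : univ ∈ 𝒱 := by
    rw [h𝒱, mem_pullback_iff, Finset.map_univ_equiv]
    exact htop
  -- the two indicator functions are the relabelled indicator functions of `𝒱`
  have hlast_mem : ∀ S : Finset (Fin (k + 1)), Fin.last k ∈ S ↔ t₀ ∈ S.map σ.toEmbedding := by
    intro S
    rw [Finset.mem_map_equiv]
    have : σ.symm t₀ = Fin.last k := by
      rw [hσ, Equiv.symm_swap, Equiv.swap_apply_left]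
    rw [this]
  have e1 : PhiCert.actV σ (fun S => if S ∈ 𝒰 then (1 : ℝ) else 0) = fun S => if S ∈ 𝒱 then (1 : ℝ) else 0 := by
    funext S
    unfold PhiCert.actV
    simp only [h𝒱, mem_pullback_iff]
  have e2 : PhiCert.actV σ (fun S => if S ∈ 𝒰 ∨ t₀ ∈ S then (1 : ℝ) else 0) =
      fun S => if S ∈ 𝒱 ∨ Fin.last k ∈ S then (1 : ℝ) else 0 := by
    funext S
    unfold PhiCert.actV
    simp only [h𝒱, mem_pullback_iff, hlast_mem]
  rw [← PhiCert.phiSet_actV σ (fun S => if S ∈ 𝒰 then (1 : ℝ) else 0),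
    ← PhiCert.phiSet_actV σ (fun S => if S ∈ 𝒰 ∨ t₀ ∈ S then (1 : ℝ) else 0), e1, e2]
  exact ⟨phiSet_indicator_capFamily_nonneg 𝒱, phiSet_indicator_capFamily_le 𝒱 hV hVtop⟩

/-! ### Cycle form -/

/-- `Φ` of an indicator function in cycle form: the signed count of the permutations all of whose cycle supports satisfy the
predicate. [this work] -/
theorem phiSet_indicator_eq_sum_perm (P : Finset (Fin (k + 1)) → Prop) [DecidablePred P] :
    phiSet (k + 1) (fun S => if P S then (1 : ℝ) else 0) =
      ∑ σ ∈ (univ : Finset (Equiv.Perm (Fin (k + 1)))).filter (fun σ => ∀ B ∈ CycleForm.orbits σ, P B),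
        (-1 : ℝ) ^ ((CycleForm.orbits σ).card - 1) := by
  rw [PhiVertex.phiSet_eq_sum_perm, ← sum_filter_add_sum_filter_not univ (fun σ => ∀ B ∈ CycleForm.orbits σ, P B)]
  have hin : ∀ σ ∈ univ.filter (fun σ : Equiv.Perm (Fin (k + 1)) => ∀ B ∈ CycleForm.orbits σ, P B),
      (-1 : ℝ) ^ ((CycleForm.orbits σ).card - 1) * ∏ B ∈ CycleForm.orbits σ, (if P B then (1 : ℝ) else 0) =
        (-1 : ℝ) ^ ((CycleForm.orbits σ).card - 1) := by
    intro σ hσ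
    rw [prod_eq_one fun B hB => if_pos ((mem_filter.1 hσ).2 B hB), mul_one]
  have hout : ∀ σ ∈ univ.filter (fun σ : Equiv.Perm (Fin (k + 1)) => ¬ ∀ B ∈ CycleForm.orbits σ, P B),
      (-1 : ℝ) ^ ((CycleForm.orbits σ).card - 1) * ∏ B ∈ CycleForm.orbits σ, (if P B then (1 : ℝ) else 0) = 0 := by
    intro σ hσ
    have hex : ∃ B ∈ CycleForm.orbits σ, ¬ P B := by
      have h2 := (mem_filter.1 hσ).2
      push Not at h2
      exact h2
    obtain ⟨B, hB, hBU⟩ := hex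
    rw [prod_eq_zero hB (if_neg hBU), mul_zero]
  rw [sum_congr rfl hin, sum_congr rfl hout, sum_const_zero, add_zero]

/-- **(V♯) in cycle form, every order.**  For a union-closed family `𝒰 ∋ univ` of subsets of `Fin (k+1)` and any index `t₀`:
`0 ≤ Σ_{σ : every cycle support ∈ 𝒰 or ∋ t₀} (−1)^{#cyc(σ)−1} ≤ Σ_{σ : every cycle support ∈ 𝒰} (−1)^{#cyc(σ)−1}`.
(The middle term equals `#{τ ∈ Sym(T∖t₀) : no cycle support of τ in 𝒰}`, memo §2 — gen 16's (V♯).) [this work] -/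
theorem sum_perm_sign_capFamily_le (𝒰 : Finset (Finset (Fin (k + 1)))) (hU : ∀ A ∈ 𝒰, ∀ B ∈ 𝒰, A ∪ B ∈ 𝒰)
    (htop : univ ∈ 𝒰) (t₀ : Fin (k + 1)) :
    0 ≤ ∑ σ ∈ (univ : Finset (Equiv.Perm (Fin (k + 1)))).filter (fun σ => ∀ B ∈ CycleForm.orbits σ, B ∈ 𝒰 ∨ t₀ ∈ B),
        (-1 : ℝ) ^ ((CycleForm.orbits σ).card - 1) ∧
      ∑ σ ∈ (univ : Finset (Equiv.Perm (Fin (k + 1)))).filter (fun σ => ∀ B ∈ CycleForm.orbits σ, B ∈ 𝒰 ∨ t₀ ∈ B),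
        (-1 : ℝ) ^ ((CycleForm.orbits σ).card - 1) ≤
      ∑ σ ∈ (univ : Finset (Equiv.Perm (Fin (k + 1)))).filter (fun σ => ∀ B ∈ CycleForm.orbits σ, B ∈ 𝒰),
        (-1 : ℝ) ^ ((CycleForm.orbits σ).card - 1) := by
  have h := phiSet_indicator_capFamily_le_of_mem 𝒰 hU htop t₀
  rw [phiSet_indicator_eq_sum_perm (fun S => S ∈ 𝒰 ∨ t₀ ∈ S), phiSet_indicator_eq_sum_perm (fun S => S ∈ 𝒰)] at h
  exact h

end PhiVertexSharp

end Summit.CriticalPhenomena.PercolationContinuityZ3.Theorems
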